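import Summits.QuantumAdvantage.AdviceFreeQNC0.HiddenCoins
import Summits.QuantumAdvantage.AdviceFreeQNC0.AffBells22WalkHardAllSubcube
import HarnessLib

/-!
# Lemma J_m — HIDDEN COINS, part 2/2: the fibre reduction `hiddenCoinsReduction : HiddenCoinsReduction` and
# `J_4` `hiddenCoinsFour : HiddenCoinsFour` (planner qa-qnc0-p2 g20, ROUND-20 (p2) §2; ask P2-20a; item stmt-QuantumAdvantage-27289)

A strategy for α's u-walk game `ringWinU c y` all of whose cuts read only a common set `J` of input bits, `|J| + m ≤ n`
(arbitrary tables, any complexity, any positions), wins on at most `(k/2^m)·2ⁿ` inputs whenever the free-phase oblivious game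
`G_m` is bounded by `k` (`FreePhase.Bound m k`, part 1).  PROOF (ROUND-20 §2; the reduction audited by qa-qnc0-ref g67, R-20 (i)):
choose a visible set `W ⊇ J` with `|W| = n − m`; on the subcube `{u_W = a_W}` (the tree's `Subcube.ext W a v` of
`AffBells22SubcubeWalk.lean`, free = hidden coordinates enumerated increasingly by `Subcube.emb`) every cut output is constant,
the walk exponent splits as `walkExp (ext W a v) g = t_g(a) + walkExp v (cut W g)` (`HiddenCoins.walkExp_ext`, `cut W g =
#{hidden i < g}`, `Subcube.emb_lt_iff`), `walkExp v j ≡ V_j(v)` (`FreePhase.V`), and the XOR over the fired cuts preceded by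
exactly `j` hidden coins of the indicators `[V_j(v) ≠ −t_g]` is `0` or a single indicator `[V_j(v) ≠ a]` — the even-weight
subspace `{0, [·≠0], [·≠1], [·≠2]}` of `𝔽₂^{ℤ/3}` is closed under `⊕` (`HiddenCoins.exists_opt_parity`).  Hence on each fibre
`ringWinU c y (ext W a ·) = FreePhase.win (n−|W|) φ` for one free-phase strategy `φ` (`HiddenCoins.fibre_win_eq`), each of the
`2^{|W|}` fibres carries `≤ k` wins (`HiddenCoins.card_win_le`), and `2^{|W|}·k = (k/2^m)·2ⁿ`.
Main results: `hiddenCoinsReduction : HiddenCoinsReduction`, `hiddenCoinsFour : HiddenCoinsFour` (`θ = 3/4` for EVERY common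
junta `|J| ≤ n − 4`; the tree's `walkHardFJunta` needs `|J| ≤ (log₂ n)^C` and gives `θ = 1 − η₀/4`).
WHAT THIS IS NOT: coins read by even two adaptive cuts break the reduction (R8/FewReaders is not replaced); nothing is hidden from
dense linear tests (M19's posts); rung F-Q2-odd instrument; separation NOT moved.
-/

namespace Summit.QuantumAdvantage.AdviceFreeQNC0

open Finset

/-! ### The fibre reduction -/

namespace HiddenCoins

open AffBells22 Subcube

/-! #### Parities of indicator counts on `ZMod 3`: the even-weight subspace `{0, [· ≠ 0], [· ≠ 1], [· ≠ 2]}` -/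

/-- Evaluation of an optional phase: `none ↦ 0`, `some b ↦ [z ≠ b]` (the shape of `FreePhase.live`). -/
def optLive (o : Option (ZMod 3)) (z : ZMod 3) : Bool :=
  match o with
  | none => false
  | some b => decide (z ≠ b)

/-- `[z ≠ b'] ⊕ [z ≠ b] = [z ≠ −(b + b')]` for `b' ≠ b` (the third residue). -/
private theorem ne_xor_ne : ∀ b b' z : ZMod 3, b' ≠ b →
    (decide (z ≠ b') ^^ decide (z ≠ b)) = decide (z ≠ -(b + b')) := by
  decide

/-- Closure under `⊕ [· ≠ b]`. -/
theorem optLive_xor (o : Option (ZMod 3)) (b : ZMod 3) :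
    ∃ o' : Option (ZMod 3), ∀ z, (optLive o z ^^ decide (z ≠ b)) = optLive o' z := by
  rcases o with _ | b'
  · exact ⟨some b, fun z => by simp [optLive]⟩
  · by_cases h : b' = b
    · subst h
      exact ⟨none, fun z => by simp [optLive]⟩
    · exact ⟨some (-(b + b')), fun z => by simp only [optLive]; exact ne_xor_ne b b' z h⟩

/-- Adding one to a count flips its parity bit. -/
private theorem decide_succ_mod_two (C : ℕ) : decide ((C + 1) % 2 = 1) = (decide (C % 2 = 1) ^^ true) := by
  rcases Nat.mod_two_eq_zero_or_one C with h | h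
  · have h1 : (C + 1) % 2 = 1 := by omega
    simp [h, h1]
  · have h1 : (C + 1) % 2 = 0 := by omega
    simp [h, h1]

/-- **The XOR of any family of indicators `[z ≠ a_g]` is `0` or a single indicator `[z ≠ a]`.** -/
theorem exists_opt_parity {ι : Type*} [DecidableEq ι] (G : Finset ι) (ph : ι → ZMod 3) :
    ∃ o : Option (ZMod 3), ∀ z : ZMod 3, decide ((G.filter fun g => z ≠ ph g).card % 2 = 1) = optLive o z := by
  induction G using Finset.induction_on with
  | empty => exact ⟨none, fun z => by simp [optLive]⟩
  | insert g G hg ih =>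
    obtain ⟨o, ho⟩ := ih
    obtain ⟨o', ho'⟩ := optLive_xor o (ph g)
    refine ⟨o', fun z => ?_⟩
    rw [← ho' z, ← ho z, filter_insert]
    by_cases hz : z ≠ ph g
    · rw [if_pos hz, card_insert_of_notMem (fun h => hg (mem_filter.1 h).1), decide_succ_mod_two]
      simp [hz]
    · rw [if_neg hz]
      simp [hz]

/-- Parity of the number of odd counts = parity of the total count. -/
theorem card_filter_odd_mod_two {ι : Type*} (s : Finset ι) (cnt : ι → ℕ) :
    (s.filter fun j => cnt j % 2 = 1).card % 2 = (∑ j ∈ s, cnt j) % 2 := by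
  rw [Finset.sum_nat_mod, Finset.card_filter]
  congr 1
  refine Finset.sum_congr rfl fun j _ => ?_
  rcases Nat.mod_two_eq_zero_or_one (cnt j) with h | h <;> simp [h]

/-! #### The walk exponent on a coordinate subcube -/

variable {n : ℕ} (W : Finset (Fin n)) (a : Fin n → Bool)

/-- `Wᶜ` is the image of the increasing enumeration `emb W` of the free (hidden) coordinates. -/
private theorem compl_eq_map_emb :
    (Wᶜ : Finset (Fin n)) = univ.map ((Wᶜ).orderEmbOfFin (card_compl_eq W)).toEmbedding :=
  (Finset.map_orderEmbOfFin_univ _ _).symm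

/-- A count over all coordinates splits into the `W`-part and the part along `emb W`. -/
private theorem card_filter_split (P : Fin n → Prop) [DecidablePred P] :
    (univ.filter P).card = (W.filter P).card + (univ.filter fun j : Fin (n - W.card) => P (emb W j)).card := by
  rw [Finset.card_filter, Finset.card_filter, Finset.card_filter, ← Finset.sum_add_sum_compl W,
    compl_eq_map_emb W, Finset.sum_map]
  rfl

/-- **Weight splitting**: `wt (ext W a v) = #{i ∈ W : a_i} + wt v`. -/
theorem wt_ext (v : Fin (n - W.card) → Bool) :
    wt (ext W a v) = (W.filter fun i => a i = true).card + wt v := by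
  unfold wt
  rw [card_filter_split W]
  congr 1
  · exact congrArg Finset.card (filter_congr fun i hi => by rw [ext_of_mem W a v hi])
  · exact congrArg Finset.card (filter_congr fun j _ => by rw [ext_emb])

/-- **Prefix-weight splitting**: `wtPrefix (ext W a v) g = #{i ∈ W : i < g, a_i} + wtPrefix v (cut W g)` — the hidden
coordinates below `g` are exactly the first `cut W g` of them (`Subcube.emb_lt_iff`). -/
theorem wtPrefix_ext (v : Fin (n - W.card) → Bool) (g : ℕ) :
    wtPrefix (ext W a v) g = (W.filter fun i => i.val < g ∧ a i = true).card + wtPrefix v (cut W g) := by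
  unfold wtPrefix
  rw [card_filter_split W]
  congr 1
  · exact congrArg Finset.card (filter_congr fun i hi => by rw [ext_of_mem W a v hi])
  · exact congrArg Finset.card (filter_congr fun j _ => by rw [ext_emb, emb_lt_iff])

/-- **Walk-exponent splitting**: `walkExp (ext W a v) g = t_g(a) + walkExp v (cut W g)` with the visible part
`t_g(a) = #{i ∈ W : a_i} + #{i ∈ W : i < g, a_i}`. -/
theorem walkExp_ext (v : Fin (n - W.card) → Bool) (g : ℕ) :
    walkExp (ext W a v) g =
      ((W.filter fun i => a i = true).card + (W.filter fun i => i.val < g ∧ a i = true).card) +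
        walkExp v (cut W g) := by
  unfold walkExp
  rw [wt_ext, wtPrefix_ext]
  ring

/-- `cut W g ≤ n − |W|` (it counts free coordinates). -/
theorem cut_le (g : ℕ) : cut W g ≤ n - W.card := by
  unfold cut
  exact (card_filter_le _ _).trans (by rw [card_univ, Fintype.card_fin])

/-- The position of cut `g` in the free-phase game: the number of hidden coins before it. -/
def jOf (g : Fin (n + 1)) : Fin (n - W.card + 1) := ⟨cut W g.val, Nat.lt_succ_of_le (cut_le W g.val)⟩

/-- `(T + E) mod 3 ≠ 0 ↔ E ≢ −T (mod 3)`. -/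
private theorem mod_three_ne_zero_iff (T E : ℕ) : (T + E) % 3 ≠ 0 ↔ ((E : ZMod 3) ≠ -((T : ℕ) : ZMod 3)) := by
  rw [ne_eq, ne_eq, ← Nat.dvd_iff_mod_eq_zero, ← ZMod.natCast_eq_zero_iff, Nat.cast_add, eq_neg_iff_add_eq_zero,
    add_comm]

/-- The hidden part of the walk exponent, mod 3, is the free-phase value `V`. -/
private theorem natCast_walkExp (m : ℕ) (v : Fin m → Bool) (j : ℕ) (hj : j < m + 1) :
    ((walkExp v j : ℕ) : ZMod 3) = FreePhase.V m v ⟨j, hj⟩ := by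
  unfold walkExp wt wtPrefix FreePhase.V
  push_cast
  congr 3
  exact filter_congr fun i _ => and_comm

/-- `FreePhase.live` is `optLive` of the chosen phase at the walk value. -/
private theorem live_eq_optLive (m : ℕ) (φ : Fin (m + 1) → Option (ZMod 3)) (x : Fin m → Bool) (j : Fin (m + 1)) :
    FreePhase.live m φ x j = optLive (φ j) (FreePhase.V m x j) := by
  unfold FreePhase.live optLive
  cases φ j <;> rfl

variable (c : ℕ) (y : Fin (n + 1) → (Fin n → Bool) → Bool)

/-- **The fibre is a play of the free-phase game.** If every cut reads only coordinates in `W`, then on the subcube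
`{u_W = a_W}` the game `ringWinU c y` coincides with `FreePhase.win (n − |W|) φ` for one free-phase strategy `φ`
(position `j` carries the XOR of the indicators of the fired cuts preceded by exactly `j` hidden coins). -/
theorem fibre_win_eq (hy : ∀ g, ∀ u u' : Fin n → Bool, (∀ i ∈ W, u i = u' i) → y g u = y g u') :
    ∃ φ : Fin (n - W.card + 1) → Option (ZMod 3), ∀ v : Fin (n - W.card) → Bool,
      ringWinU c y (ext W a v) = FreePhase.win (n - W.card) φ v := by
  classical
  -- outputs are constant on the subcube
  have hYv : ∀ (v : Fin (n - W.card) → Bool) (g : Fin (n + 1)),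
      y g (ext W a v) = y g (ext W a fun _ => false) :=
    fun v g => hy g _ _ fun i hi => by rw [ext_of_mem W a _ hi, ext_of_mem W a _ hi]
  -- the visible phases
  let T : Fin (n + 1) → ℕ := fun g =>
    c + g.val + ((W.filter fun i => a i = true).card + (W.filter fun i => i.val < g.val ∧ a i = true).card)
  let ph : Fin (n + 1) → ZMod 3 := fun g => -((T g : ℕ) : ZMod 3)
  -- the fired cuts preceded by exactly `j` hidden coins, and their K4 element
  let S : Fin (n - W.card + 1) → Finset (Fin (n + 1)) := fun j =>
    univ.filter fun g : Fin (n + 1) => y g (ext W a fun _ => false) = true ∧ cut W g.val = j.val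
  have hK : ∀ j : Fin (n - W.card + 1), ∃ o : Option (ZMod 3), ∀ z : ZMod 3,
      decide (((S j).filter fun g => z ≠ ph g).card % 2 = 1) = optLive o z :=
    fun j => exists_opt_parity (S j) ph
  choose φ hφ using hK
  refine ⟨φ, fun v => ?_⟩
  -- the win condition of a single cut on the fibre
  have hcut : ∀ g : Fin (n + 1),
      (y g (ext W a v) = true ∧ (c + g.val + walkExp (ext W a v) g.val) % 3 ≠ 0) ↔
        (y g (ext W a fun _ => false) = true ∧ FreePhase.V (n - W.card) v (jOf W g) ≠ ph g) := by
    intro g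
    rw [hYv v g, walkExp_ext, ← add_assoc, mod_three_ne_zero_iff,
      natCast_walkExp (n - W.card) v (cut W g.val) (Nat.lt_succ_of_le (cut_le W g.val))]
    rfl
  -- count the winning cuts position by position
  have hcount : (univ.filter fun g : Fin (n + 1) =>
        y g (ext W a v) = true ∧ (c + g.val + walkExp (ext W a v) g.val) % 3 ≠ 0).card =
      ∑ j : Fin (n - W.card + 1), ((S j).filter fun g => FreePhase.V (n - W.card) v j ≠ ph g).card := by
    rw [filter_congr fun g _ => hcut g,
      card_eq_sum_card_fiberwise (f := jOf W) (t := univ) fun g _ => mem_coe.2 (mem_univ _)]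
    refine Finset.sum_congr rfl fun j _ => ?_
    congr 1
    ext g
    simp only [S, mem_filter, mem_univ, true_and]
    constructor
    · rintro ⟨⟨h1, h2⟩, h3⟩
      rw [← h3]
      exact ⟨⟨h1, rfl⟩, h2⟩
    · rintro ⟨⟨h1, h2⟩, h3⟩
      have e : jOf W g = j := Fin.ext h2
      rw [← e] at h3
      exact ⟨⟨h1, h3⟩, e⟩
  -- the free-phase side
  have hlive : (univ.filter fun j : Fin (n - W.card + 1) => FreePhase.live (n - W.card) φ v j = true) =
      univ.filter fun j : Fin (n - W.card + 1) =>
        ((S j).filter fun g => FreePhase.V (n - W.card) v j ≠ ph g).card % 2 = 1 := by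
    refine filter_congr fun j _ => ?_
    rw [live_eq_optLive, ← hφ j, decide_eq_true_eq]
  -- compare the two parities
  have hpar : (univ.filter fun j : Fin (n - W.card + 1) => FreePhase.live (n - W.card) φ v j = true).card % 2 =
      (univ.filter fun g : Fin (n + 1) =>
        y g (ext W a v) = true ∧ (c + g.val + walkExp (ext W a v) g.val) % 3 ≠ 0).card % 2 := by
    rw [hlive, card_filter_odd_mod_two, hcount]
  unfold ringWinU FreePhase.win
  rw [hpar]
  generalize (univ.filter fun g : Fin (n + 1) =>
    y g (ext W a v) = true ∧ (c + g.val + walkExp (ext W a v) g.val) % 3 ≠ 0).card % 2 = r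
  by_cases hr : r = 1
  · rw [hr]; rfl
  · rw [decide_eq_false hr]
    exact (beq_eq_false_iff_ne.2 hr).symm

/-- **Per-fibre bound**: a bound for the free-phase game bounds the wins on every subcube over the visible set. -/
theorem card_win_ext_le {k : ℕ} (hB : FreePhase.Bound (n - W.card) k)
    (hy : ∀ g, ∀ u u' : Fin n → Bool, (∀ i ∈ W, u i = u' i) → y g u = y g u') :
    (univ.filter fun v : Fin (n - W.card) → Bool => ringWinU c y (ext W a v) = true).card ≤ k := by
  obtain ⟨φ, hφ⟩ := fibre_win_eq W a c y hy
  rw [filter_congr fun v _ => by rw [hφ v]]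
  exact hB φ

/-! #### Summing over the fibres -/

/-- The visible projection: keep the coordinates in `W`, zero the hidden ones. -/
def proj (u : Fin n → Bool) : Fin n → Bool := fun i => if i ∈ W then u i else false

/-- A point is the extension of its visible projection by its hidden bits. -/
theorem ext_proj_res (u : Fin n → Bool) : ext W (proj W u) (res W u) = u := by
  funext i
  unfold Subcube.ext proj
  by_cases h : i ∈ W
  · rw [dif_pos h, if_pos h]
  · rw [dif_neg h]
    unfold res
    rw [emb_idx]

/-- There are at most `2^{|W|}` visible projections. -/
theorem card_image_proj_le (s : Finset (Fin n → Bool)) : (s.image (proj W)).card ≤ 2 ^ W.card := by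
  classical
  have key : (s.image (proj W)).card ≤ (univ : Finset ({i // i ∈ W} → Bool)).card := by
    refine card_le_card_of_injOn (fun b => fun i : {i // i ∈ W} => b i.1) (fun _ _ => mem_coe.2 (mem_univ _)) ?_
    intro b₁ hb₁ b₂ hb₂ heq
    rw [mem_coe, Finset.mem_image] at hb₁ hb₂
    obtain ⟨u₁, -, rfl⟩ := hb₁
    obtain ⟨u₂, -, rfl⟩ := hb₂
    funext i
    by_cases hi : i ∈ W
    · exact congrFun heq ⟨i, hi⟩
    · unfold proj; rw [if_neg hi, if_neg hi]
  rw [card_univ, Fintype.card_fun, Fintype.card_bool, Fintype.card_coe] at key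
  exact key

/-- **Fibre sum**: if every cut reads only coordinates in `W` and the free-phase game on `n − |W|` coins is bounded
by `k`, the strategy wins on at most `2^{|W|}·k` inputs. -/
theorem card_win_le {k : ℕ} (hB : FreePhase.Bound (n - W.card) k)
    (hy : ∀ g, ∀ u u' : Fin n → Bool, (∀ i ∈ W, u i = u' i) → y g u = y g u') :
    (univ.filter fun u : Fin n → Bool => ringWinU c y u = true).card ≤ 2 ^ W.card * k := by
  classical
  set s := univ.filter fun u : Fin n → Bool => ringWinU c y u = true with hs
  rw [card_eq_sum_card_image (proj W) s]
  have hfib : ∀ b ∈ s.image (proj W), (s.filter fun u => proj W u = b).card ≤ k := by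
    intro b _
    refine le_trans ?_ (card_win_ext_le W b c y hB hy)
    refine card_le_card_of_injOn (res W) ?_ ?_
    · intro u hu
      rw [mem_coe, mem_filter, hs, mem_filter] at hu
      rw [mem_coe, mem_filter]
      refine ⟨mem_univ _, ?_⟩
      rw [← hu.2, ext_proj_res]
      exact hu.1.2
    · intro u₁ hu₁ u₂ hu₂ heq
      rw [mem_coe, mem_filter] at hu₁ hu₂
      rw [← ext_proj_res W u₁, ← ext_proj_res W u₂, hu₁.2, hu₂.2, heq]
  calc ∑ b ∈ s.image (proj W), (s.filter fun u => proj W u = b).card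
      ≤ ∑ _b ∈ s.image (proj W), k := sum_le_sum hfib
    _ = (s.image (proj W)).card * k := by rw [sum_const, smul_eq_mul]
    _ ≤ 2 ^ W.card * k := Nat.mul_le_mul_right k (card_image_proj_le W s)

end HiddenCoins

open HiddenCoins in
/-- **`HiddenCoinsReduction` — PROVED**: `FreePhase.Bound m k → HiddenCoinsBound m (k/2^m)` (choose a visible set
`W ⊇ J` with `|W| = n − m`, bound each of the `2^{n−m}` fibres by `k`). -/
theorem hiddenCoinsReduction : HiddenCoinsReduction := by
  intro m k hB n c J hJ y hy
  classical
  obtain ⟨W, hJW, -, hW⟩ := exists_subsuperset_card_eq (subset_univ J) (show J.card ≤ n - m by omega)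
    (show n - m ≤ (univ : Finset (Fin n)).card by rw [card_univ, Fintype.card_fin]; omega)
  have hm : n - W.card = m := by rw [hW]; omega
  have hB' : FreePhase.Bound (n - W.card) k := by rw [hm]; exact hB
  have hyW : ∀ g, ∀ u v : Fin n → Bool, (∀ i ∈ W, u i = v i) → y g u = y g v :=
    fun g u v h => hy g u v fun i hi => h i (hJW hi)
  have h := card_win_le W c y hB' hyW
  have hR : ((univ.filter fun u : Fin n → Bool => ringWinU c y u = true).card : ℝ) ≤ (2 : ℝ) ^ W.card * k := by
    exact_mod_cast h
  have hWm : W.card + m = n := by rw [hW]; omega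
  have hpow : (2 : ℝ) ^ W.card * (2 : ℝ) ^ m = (2 : ℝ) ^ n := by rw [← pow_add, hWm]
  have h2m : (0 : ℝ) < (2 : ℝ) ^ m := by positivity
  calc ((univ.filter fun u : Fin n → Bool => ringWinU c y u = true).card : ℝ)
      ≤ (2 : ℝ) ^ W.card * k := hR
    _ = (k : ℝ) / (2 : ℝ) ^ m * (2 : ℝ) ^ n := by
        rw [← hpow]
        field_simp

/-- **J_4 — PROVED** (`θ = 3/4`, every common junta `|J| ≤ n − 4`; item stmt-QuantumAdvantage-27289). -/
theorem hiddenCoinsFour : HiddenCoinsFour := hiddenCoinsFour_of hiddenCoinsReduction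

end Summit.QuantumAdvantage.AdviceFreeQNC0
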